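import Summits.QuantumFields.YangMills.Theorems.BalabanUVNodesK0VariationalThm1CoP7EmptySupport
import Literature.MathematicalPhysics.QuantumFieldTheory.Balaban1983to89.Node00.Record12BgRowCoClassC1

/-!
# K0⁵ ROW P11 — THE C¹ EDITION OF THE [15]-FACT: the cheap floor `VariationalThm1C1RegSepTop7M F N Sup B₃ B₃' a₀ a₁ → 0 < B₃'` (every `Sup`,
# every `N ≥ 1`, every `B₃`, `0 < a₀`, `0 < a₁`) and `VariationalThm1C1RegSepCoP7M F N B₃ B₃' a₀ a₁ → 0 < B₃'`, and WHY the corner engine has no purchase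

Cell `pub-ymgap`, seat `pub-ymgap-dag-n21-c` g9 (R134 (a) N21 NE7c s1; K0 ROW P11 negative lane of record for the [15]-fact editions; INBOX
INTENT-1 of 2026-08-27 11:53Z).  Filed `--kind proof --supports stmt-QuantumFields-20293 --as helper` (K0⁵ `Record13SepCoPInhabited`; WORDS-141).
Trigger (t22) of this lineage's HANDOFF §g8: a NEW edition of the named fact landed — node00-def-P11 FILE 13 p528185 `Node00/Record12BgRowCoClassC1.lean`,
the C¹ sentence ([15] = [Balaban1985Variational] Thm 1 (9)–(10) p. 279, gauge-invariant consequence form): ★★ `VariationalThm1C1RegSepTop7M F N Sup B₃ B₃' a₀ a₁`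
(12d's `…Top7M` binder block byte for byte, conclusion `∀ n, 1 ≤ n → n ≤ k → PlaqC1SmallOn (plaqInside (s.Ω n)) (B₃'·δ_n·η_n³) U₀`) and its selector instance
★★ `VariationalThm1C1RegSepCoP7M F N B₃ B₃' a₀ a₁` (`Sup := suppDomOfRecord`).

WHAT THIS FILE SAYS (numbers, by name).
(1) NO CORNER-ENGINE INSTANCE.  FILE 22A's engine `K0VariationalThm1Top7Engine.sq_L_lt_of_top7BodyAt` reads the (8)-conclusion at a plaquette of
`omegaPlaqsTop … 1 = plaqsOf Ω₁` PINNED to the scale-0 datum (the corner plaquette, touching convention [6] p. 77).  The C¹ predicate of record,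
FILE 7a's `PlaqC1SmallOn S δ U` (`Record12BgRowGaugeGradient`), compares `U(∂p)` with the transported `U(∂(p + e_ν))` ONLY WHEN BOTH `p` AND `p + e_ν` lie in
`S = plaqInside (s.Ω n)` (all four corners in `Ω_n`, `SmallFieldChiOfRecord.plaqInside`), `1 ≤ n`: every bond read has both endpoints in `Ω_n ⊆ Ω₁`, none is in
`bondsOf (genSet s.Ω k 0)` (`Γ₀ = Ω₁ᶜ`), so NO pinned plaquette is in range — node00-def-P11's scope note (c), here CONFIRMED.
(2) THE CHEAP FLOOR (def-P11's «expected floor», its successor trigger (t5)) made kernel: ★ `pos_of_top7C1BodyAt` (the FLAT ENGINE: the C¹-shaped body AT the instance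
⊢ `0 < B₃'`; future C¹ editions by instantiation) and ★★ `pos_of_variationalThm1C1RegSepTop7M` — at p498335's separated
one-cube index on `F.P 1` (`k = 1`, `Ω₁ = Λ₁ = π([0, L−1]⁴)`, `M = 1`, `g ≡ 1`, ANY numerics `ν₀` with `0 < ν₀.M₁`), the FLAT datum `W := M_𝐁(1)` passes print's (7)
over every top domain at every positive threshold (all its plaquette variables are `1`: `T3DescentFibreTower.avgFun_one`), the flat
configuration `U₀ ≡ 1` lies in 12b's Top class (6) (FILE 21A `mem_classTop_of_forall_dist1_lt`) and MINIMISES (5) on the fibre (`wilsonAction4 1 ≤ #Plaq·0² = 0 ≤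
wilsonAction4 U`, dag-n07-e 19a `wilsonAction4_le_card_mul_sq` + `Setup.wilsonAction4_nonneg`), and `Ω₁` holds the adjacent inside pair `⟨π(0); 0, 1⟩`,
`⟨π(e₂); 0, 1⟩` (`L ≥ 12 ≥ 2`, `d = 4 ≥ 3`); the C¹ conclusion there reads `0 = dist1 (1·1·1⁻¹·1⁻¹) < B₃'·δ₁·η₁³` with `δ₁ = min(a₁, a₀∕max(B₃,1)) > 0`, `η₁ = L⁻¹`,
whence `0 < B₃'` (only `dist1 ≥ 0` is used at the pair).  ★★ `pos_of_variationalThm1C1RegSepCoP7M` (at `ν₀ := numerics7OfRecord₁₂`, `M₁ = 1`); `not_…_of_nonpos` twins; `…CoP7M_degenerate_of_nonpos`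
(`B₃' ≤ 0` ⇒ `a₀ ≤ 0 ∨ a₁ ≤ 0`).  node00-def-K0a's 16d composite takes `(hB' : 0 ≤ B₃')`: at `B₃' = 0` its hypothesis `h15C1` is uninhabited (`0 < a₀`, `0 < a₁`).
(3) LOCATED RANGE NOTE (recorded, NOT typed, count-neutral, not a defect claim): `plaqInside (s.Ω 1)` includes the layer of `Ω₁` one fine step from `Γ₀`; print's
(9)–(10) are stated on class cubes whose enlargements sit inside `Ω_j∖Ω_{j+2}` ([15] p. 279; def-P11's docstring absorbs the collar into `B₃'`).  At the one-cube
index with dag-n07-e 19a's single-bond corner twist of size `t < δ₀ ≤ 2δ₁` the (2.12) minimiser's covariant plaquette gradient next to the corner is of order `t`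
(linear response), so the typed sentence's true inhabitation floor is `B₃' ≳ c·L³` — a LETTER the consumers' free `B₃'` absorbs (as `2L² ≤ B₃` for (8)); certifying
it needs a LOWER bound on the minimiser's response, i.e. solving (2.12) — no tree tool, not pursued here.
(4) READER'S POINTER (dag-n07-e g8 LANDED-22c, INBOX l.19473): FILE 22B §4's `two_sq_L_le_of_prop8RegSepPrinted` is keyed on the v1.0 fact
`Prop8RegSepPrinted`, whose antecedent is now KERNEL-REFUTED for every `B₃` (`N07Prop8LevelZeroObstruction.not_prop8RegSepPrinted`, p528837); the live
Prop-8 floors are the STEP-keyed `two_sq_L_le_of_prop8RegSepStep` ∕ `two_sq_L_le_of_prop8RegSepTopStep` (22B §4).  Nothing here keys on a Prop-8 fact.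

HONEST FRAMING: kernel non-vacuity ∕ floor bookkeeping about TREE-typed named facts (`Prop`s with parameters, never asserted); nothing of Bałaban asserted or
refuted ([15] p. 279: «positive constants»); K0⁵ neither discharged nor refuted; N21 NOT discharged; NE7c NOT PRINTED ∕ NOT PROVED; counts unmoved (typed
28∕28 · discharged 5∕28); one finite `𝕋⁴` torus family at fixed `ε = L^{−K}`; not continuum ∕ OS ∕ mass gap ∕ Clay.  THEOREMS ONLY: no `def`, `instance`,
`notation`, `sorry`; standard axioms.
DEPENDENCES (by name, CITED not restated): node00-def-P11 FILE 13 `VariationalThm1C1RegSepTop7M ∕ …CoP7M ∕ .toTop7M` (p528185), FILE 7a `PlaqC1SmallOn`,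
12a `Sect2.DataSmall7PTop ∕ omegaPlaqsTop ∕ CoDivClassOnTop`; this lineage's FILE 16 `exists_seq_singleCube ∕ cover_zero_mem_cubeEnl_zero ∕ lt_sitesPerDir_zero`
(p498335), FILE 21A `mem_classTop_of_forall_dist1_lt` (p522268), FILE 12 `shift_cover` (p488412); dag-n07-e 19a `wilsonAction4_le_card_mul_sq ∕ mixedField_avg_self`
(p509187); ym3 `T3DescentFibreTower.avgFun_one ∕ expMeanLogSU_E_one`; r11 `IsMinimizer ∕ AgreeOn ∕ avgFamily ∕ genSet`;
NODE 00 `avOfRecord_avg`, `numerics7OfRecord₁₂`, `Setup.wilsonAction4_nonneg`.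
-/

noncomputable section

open scoped Matrix.Norms.L2Operator

namespace Summit.QuantumFields.YangMills.Theorems.K0VariationalThm1C1Floor

open Literature.MathematicalPhysics.QuantumFieldTheory.Balaban1983to89
open Literature.MathematicalPhysics.QuantumFieldTheory.Balaban1983to89.Node00
open Literature.MathematicalPhysics.QuantumFieldTheory.Balaban1983to89.T4Continuum
open B15Eq112TorusCover B14DomainGeom B15DeterminingSets B15LatticeCubeTorus BlockAveraging
open Literature.MathematicalPhysics.QuantumFieldTheory.Balaban1983to89.T3DescentFibreTower (avgFun_one expMeanLogSU_E_one)
open ExpMeanLog (expMeanLogSU)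
open Summit.QuantumFields.YangMills.Theorems.K0BgProvisoOverRange (shift_cover)
open Summit.QuantumFields.YangMills.Theorems.K0VariationalThm1ScaledCorner (cover_zero_mem_cubeEnl_zero exists_seq_singleCube lt_sitesPerDir_zero)
open Summit.QuantumFields.YangMills.BalabanUVNodes.N07SmallActionBoundaryAvoidance (wilsonAction4_le_card_mul_sq mixedField_avg_self)
open Summit.QuantumFields.YangMills.Theorems.K0TopClassSmallActionMinimiser (mem_classTop_of_forall_dist1_lt)

/-! ## §1  Geometry: an adjacent pair of plaquettes INSIDE the cube `π([0, s−1]ᵈ)` -/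
section Geometry

variable {P : Params}

/-- A lattice point with coordinates in `{0, 1}` lies in the cube `π([0, s−1]ᵈ)` of index `0` whenever `s ≥ 2`. [cite: Balaban1988Convergent, (2.1) p.254 (bookkeeping)] -/
theorem cover_mem_cubeEnl_zero_of_le_one {s : ℕ} (hs : 2 ≤ s) {w : Pt P.d} (hw : ∀ i, 0 ≤ w i ∧ w i ≤ 1) : cover P w ∈ cubeEnl P s 0 0 := by
  refine ⟨w, fun i => ?_, rfl⟩
  have hs' : (2 : ℤ) ≤ s := by exact_mod_cast hs
  obtain ⟨h0, h1⟩ := hw i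
  simp only [Pi.zero_apply, mul_zero, Nat.zero_mul, Nat.cast_zero, sub_zero, add_zero, zero_add]
  exact ⟨h0, by linarith⟩

/-- Bumping a zero coordinate of a `{0, 1}`-valued lattice vector keeps it `{0, 1}`-valued. [cite: Balaban1988Convergent, (2.1) p.254 (bookkeeping)] -/
theorem update_le_one {w : Pt P.d} (hw : ∀ i, 0 ≤ w i ∧ w i ≤ 1) {μ : Fin P.d} (hμ : w μ = 0) :
    ∀ i, 0 ≤ Function.update w μ (w μ + 1) i ∧ Function.update w μ (w μ + 1) i ≤ 1 := by
  intro i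
  by_cases h : i = μ
  · subst h; rw [Function.update_self, hμ]; norm_num
  · rw [Function.update_of_ne h]; exact hw i

/-- **AN ADJACENT PAIR OF INSIDE PLAQUETTES** (`d ≥ 3`, cube side `s ≥ 2`): the plaquette `p = ⟨π(0); 0, 1⟩` and its translate `p + e₂ = ⟨π(e₂); 0, 1⟩` both lie
in `plaqInside (π([0, s−1]ᵈ))` (all eight corners have coordinates in `{0, 1}`) — a pair in the range of FILE 7a's `PlaqC1SmallOn (plaqInside Ω₁)`.
[cite: Balaban1988Convergent, (2.17) p.257; Balaban1985Variational, Thm 1 (9)–(10) p.279 (bookkeeping)] -/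
theorem exists_adjacent_plaqInside_cube (hd : 3 ≤ P.d) {s : ℕ} (hs : 2 ≤ s) :
    ∃ (p : Plaq P 0) (κ : Fin P.d), p ∈ plaqInside (cubeEnl P s 0 0) ∧
      (⟨p.src.shift κ, p.μ, p.ν, p.hμν⟩ : Plaq P 0) ∈ plaqInside (cubeEnl P s 0 0) := by
  set μ : Fin P.d := ⟨0, by omega⟩ with hμ
  set ν : Fin P.d := ⟨1, by omega⟩ with hν
  set κ : Fin P.d := ⟨2, by omega⟩ with hκ
  have hμν' : μ ≠ ν := by intro h; have := congrArg Fin.val h; simp [hμ, hν] at this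
  have hμκ : μ ≠ κ := by intro h; have := congrArg Fin.val h; simp [hμ, hκ] at this
  have hνκ : ν ≠ κ := by intro h; have := congrArg Fin.val h; simp [hν, hκ] at this
  have hμν : μ < ν := Fin.mk_lt_mk.2 (by norm_num)
  have h0 : ∀ i, 0 ≤ (0 : Pt P.d) i ∧ (0 : Pt P.d) i ≤ 1 := fun i => by simp
  -- the eight corners: `0`, `e_μ`, `e_ν`, `e_μ + e_ν` and their `e_κ`-translates
  have hmem : ∀ w : Pt P.d, (∀ i, 0 ≤ w i ∧ w i ≤ 1) → w μ = 0 → w ν = 0 →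
      (⟨cover P w, μ, ν, hμν⟩ : Plaq P 0) ∈ plaqInside (cubeEnl P s 0 0) := by
    intro w hw hwμ hwν
    have h1 := update_le_one hw hwμ
    have h2 := update_le_one hw hwν
    have hwνμ : Function.update w μ (w μ + 1) ν = 0 := by rw [Function.update_of_ne hμν'.symm, hwν]
    have h3 := update_le_one h1 hwνμ
    refine ⟨cover_mem_cubeEnl_zero_of_le_one hs hw, ?_, ?_, ?_⟩
    · show (cover P w).shift μ ∈ _
      rw [shift_cover]; exact cover_mem_cubeEnl_zero_of_le_one hs h1
    · show (cover P w).shift ν ∈ _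
      rw [shift_cover]; exact cover_mem_cubeEnl_zero_of_le_one hs h2
    · show ((cover P w).shift μ).shift ν ∈ _
      rw [shift_cover, shift_cover]; exact cover_mem_cubeEnl_zero_of_le_one hs h3
  refine ⟨⟨cover P 0, μ, ν, hμν⟩, κ, hmem 0 h0 rfl rfl, ?_⟩
  show (⟨(cover P (0 : Pt P.d)).shift κ, μ, ν, hμν⟩ : Plaq P 0) ∈ _
  rw [shift_cover]
  exact hmem _ (update_le_one h0 rfl) (by rw [Function.update_of_ne hμκ]; rfl) (by rw [Function.update_of_ne hνκ]; rfl)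

end Geometry

/-! ## §2  The floor `0 < B₃'` for the C¹ editions -/
section Floor

variable {F : T4Family} {N : ℕ} [NeZero N]

/-- **★ THE FLAT ENGINE.**  For ANY numerics `ν₀` and ANY top-domain selector `Sup`: if the `VariationalThm1C1RegSepTop7M`-SHAPED body holds AT the instance
`(ν₀, M = 1, g ≡ 1, K = k = 1)` (FILE 13's `…C1RegSepTop7M` ∕ `…C1RegSepCoP7M` supply it when `0 < ν₀.M₁`; a future edition with the same C¹ conclusion by instantiation),
then `0 < B₃'` (`0 < a₀`, `0 < a₁`, every `N ≥ 1`, every `B₃`).  Instance: `F.P 1`, p498335's separated one-cube index (`Ω₁ = π([0, L−1]⁴)`), thresholds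
`δ₀ = δ₁ = min(a₁, a₀∕max(B₃,1))`, `ε₀ = a₀`, the FLAT datum `W = M_𝐁(1)` (print's (7) over any top domain: every plaquette variable is `1`), the flat minimiser
`U₀ ≡ 1` (in the Top class (6); `A(1) = 0 ≤ A(U)`), the adjacent inside pair `⟨π(0); 0,1⟩`, `⟨π(e₂); 0,1⟩`: the conclusion there and `dist1 ≥ 0` give `0 < B₃'·δ₁·η₁³`.
[cite: Balaban1985Variational, (2),(5),(6),(7) p.278, Thm 1 (9)–(10) p.279; Balaban1985RegularSpaces, (1.3)–(1.9) p.77; Balaban1988Convergent, (2.2) p.255, (2.10)–(2.12) p.256, (2.17) p.257 (bookkeeping)] -/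
theorem pos_of_top7C1BodyAt (Sup : (ν : Stage7Numerics) → (K : ℕ) → (ℕ → Set (Site (F.P K) 0)) → Set (Site (F.P K) 0))
    (ν₀ : Stage7Numerics) {B₃ B₃' a₀ a₁ : ℝ} (ha₀ : 0 < a₀) (ha₁ : 0 < a₁)
    (h : ∀ s : SeqOfRecord F ν₀ 1 (fun _ => (1 : ℝ)) 1 1, Sect2.SeqSeparated ν₀.M₁ s → ∀ (ε₀ : ℝ) (δ : ℕ → ℝ),
      (∀ n, n ≤ 1 → 0 < δ n ∧ δ n ≤ a₁ ∧ B₃ * δ n ≤ ε₀) → (∀ n, n < 1 → δ n ≤ 2 * δ (n + 1)) → (∀ n, n < 1 → δ (n + 1) ≤ 2 * δ n) → ε₀ ≤ a₀ →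
      ∀ W : MSField (F.P 1) (SU N), Sect2.DataSmall7PTop (avOfRecord F N 1) s.Ω (Sup ν₀ 1 s.Ω) 1 δ W →
        ∀ U₀, IsMinimizer (avOfRecord F N 1)
            {U | (∀ n, n ≤ 1 → PlaqSmallOn (Sect2.omegaPlaqsTop s.Ω (Sup ν₀ 1 s.Ω) n) (ε₀ * (F.P 1).eta n ^ 2) U) ∧
              Sect2.CoDivClassOnTop s.Ω (Sup ν₀ 1 s.Ω) 1 ε₀ U} (genSet s.Ω 1) W U₀ →
          ∀ n, 1 ≤ n → n ≤ 1 → PlaqC1SmallOn (plaqInside (s.Ω n)) (B₃' * δ n * (F.P 1).eta n ^ 3) U₀) :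
    0 < B₃' := by
  classical
  -- the torus `F.P 1`
  set P : Params := F.P 1 with hPdef
  have hPL : P.L = F.L := T4Family.P_L F 1
  have hPd : P.d = 4 := T4Family.P_d F 1
  have hL11 : 11 < F.L := F.hL11
  have hL2 : 2 ≤ P.L := by rw [hPL]; omega
  have hd3 : 3 ≤ P.d := by rw [hPd]; norm_num
  have hd1 : 1 ≤ P.d := by rw [hPd]; norm_num
  have hLR : (12 : ℝ) ≤ F.L := by exact_mod_cast (show 12 ≤ F.L by omega)
  have hη1 : P.eta 1 = ((F.L : ℝ))⁻¹ := by simp [Params.eta, hPL]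
  have hηpos : 0 < P.eta 1 := by rw [hη1]; positivity
  have hη3pos : 0 < P.eta 1 ^ 3 := pow_pos hηpos 3
  -- the index `k = 1`, `Ω₁ = B(0)`
  obtain ⟨s, hsΩ, hsep⟩ := exists_seq_singleCube F ν₀ 1
  have hsΩ' : s.Ω 1 = cubeEnl P P.L 0 0 := by rw [hsΩ, hPL]
  -- thresholds `δ₀ = δ₁ = δ'`, `ε₀ = a₀`
  obtain ⟨β, hβ⟩ : ∃ β : ℝ, β = max B₃ 1 := ⟨_, rfl⟩
  have hβ1 : 1 ≤ β := by rw [hβ]; exact le_max_right _ _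
  have hβpos : 0 < β := by linarith only [hβ1]
  have hβB : B₃ ≤ β := by rw [hβ]; exact le_max_left _ _
  obtain ⟨δ', hδ'⟩ : ∃ δ' : ℝ, δ' = min a₁ (a₀ / β) := ⟨_, rfl⟩
  have hδ'pos : 0 < δ' := by rw [hδ']; exact lt_min ha₁ (by positivity)
  have hδ'a₁ : δ' ≤ a₁ := by rw [hδ']; exact min_le_left _ _
  have hδ'β : δ' ≤ a₀ / β := by rw [hδ']; exact min_le_right _ _
  have hBδ' : B₃ * δ' ≤ a₀ := by
    calc B₃ * δ' ≤ β * δ' := mul_le_mul_of_nonneg_right hβB hδ'pos.le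
      _ ≤ β * (a₀ / β) := mul_le_mul_of_nonneg_left hδ'β hβpos.le
      _ = a₀ := by field_simp
  set δ : ℕ → ℝ := fun _ => δ' with hδdef
  have hδ : ∀ n, n ≤ 1 → 0 < δ n ∧ δ n ≤ a₁ ∧ B₃ * δ n ≤ a₀ := fun n _ => ⟨hδ'pos, hδ'a₁, hBδ'⟩
  have hcomp : ∀ n, n < 1 → δ n ≤ 2 * δ (n + 1) := fun n _ => by show δ' ≤ 2 * δ'; linarith only [hδ'pos]
  have hcomp' : ∀ n, n < 1 → δ (n + 1) ≤ 2 * δ n := fun n _ => by show δ' ≤ 2 * δ'; linarith only [hδ'pos]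
  -- the flat datum `W = M_𝐁(1)`
  set U₁ : GaugeField P 0 (Matrix.specialUnitaryGroup (Fin N) ℂ) := 1 with hU₁
  set W : MSField P (Matrix.specialUnitaryGroup (Fin N) ℂ) := avgFamily (avOfRecord F N 1) U₁ with hW
  -- every plaquette variable of a flat configuration is `1`
  have hpl1 : ∀ {j : ℕ} (q : Plaq P j), GaugeField.plaqHol (1 : GaugeField P j (Matrix.specialUnitaryGroup (Fin N) ℂ)) q = 1 :=
    fun q => by
      show (1 : Matrix.specialUnitaryGroup (Fin N) ℂ) * 1 * (1 : Matrix.specialUnitaryGroup (Fin N) ℂ)⁻¹ *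
        (1 : Matrix.specialUnitaryGroup (Fin N) ℂ)⁻¹ = 1
      simp
  have hone : ∀ {j : ℕ} (q : Plaq P j), dist1 (GaugeField.plaqHol (1 : GaugeField P j (Matrix.specialUnitaryGroup (Fin N) ℂ)) q) = 0 :=
    fun q => by rw [hpl1, GaugeGroup.dist1_one]
  have hU₁q : ∀ q : Plaq P 0, dist1 (GaugeField.plaqHol U₁ q) = 0 := fun q => by rw [hU₁]; exact hone q
  have h7top : Sect2.DataSmall7PTop (avOfRecord F N 1) s.Ω (Sup ν₀ 1 s.Ω) 1 δ W := by
    refine ⟨fun q _ => ?_, fun m hm q _ => ?_⟩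
    · show dist1 (GaugeField.plaqHol U₁ q) < δ'
      rw [hU₁q]; exact hδ'pos
    · have hm0 : m = 0 := by omega
      subst hm0
      show dist1 (GaugeField.plaqHol (Sect2.mixedField (avOfRecord F N 1) (genSet s.Ω 1 (0 + 1))
        ((avOfRecord F N 1 0).avg U₁) U₁) q) < δ'
      rw [mixedField_avg_self, avOfRecord_avg, hU₁, avgFun_one expMeanLogSU expMeanLogSU_E_one, hone]
      exact hδ'pos
  -- the flat minimiser `U₀ ≡ 1` over the Top class
  obtain ⟨r, hr⟩ : ∃ r : ℝ, r = a₀ * P.eta 1 ^ 3 / (4 * P.d) := ⟨_, rfl⟩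
  have hdpos : (0 : ℝ) < P.d := by rw [hPd]; norm_num
  have hrpos : 0 < r := by rw [hr]; positivity
  have hrη : (P.d : ℝ) * (2 * r) < a₀ * P.eta 1 ^ 3 := by
    rw [hr]
    have hpos : 0 < a₀ * P.eta 1 ^ 3 := by positivity
    have heq : (P.d : ℝ) * (2 * (a₀ * P.eta 1 ^ 3 / (4 * P.d))) = a₀ * P.eta 1 ^ 3 / 2 := by
      field_simp; ring
    rw [heq]; linarith only [hpos]
  have h1reg := mem_classTop_of_forall_dist1_lt (N := N) hd1 s.Ω (Sup ν₀ 1 s.Ω) 1 hrpos.le hrη (U := U₁)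
    (fun q => by rw [hU₁q]; exact hrpos)
  have hA : AgreeOn (genSet s.Ω 1) (avgFamily (avOfRecord F N 1) U₁) W := fun _ _ _ => rfl
  have hA0 : wilsonAction4 U₁ ≤ 0 := by
    have h1 := wilsonAction4_le_card_mul_sq (U := U₁) (t := 0) (fun q => (hU₁q q).le)
    simpa using h1
  have hmin : IsMinimizer (avOfRecord F N 1)
      {U | (∀ n, n ≤ 1 → PlaqSmallOn (Sect2.omegaPlaqsTop s.Ω (Sup ν₀ 1 s.Ω) n) (a₀ * P.eta n ^ 2) U) ∧
        Sect2.CoDivClassOnTop s.Ω (Sup ν₀ 1 s.Ω) 1 a₀ U} (genSet s.Ω 1) W U₁ :=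
    ⟨h1reg, hA, fun U _ _ => hA0.trans (wilsonAction4_nonneg U)⟩
  -- the C¹ conclusion at the adjacent inside pair
  have hC1 := h s hsep a₀ δ hδ hcomp hcomp' le_rfl W h7top U₁ hmin 1 le_rfl le_rfl
  obtain ⟨p, κ, hp, hp'⟩ := exists_adjacent_plaqInside_cube (P := P) hd3 hL2
  rw [← hsΩ'] at hp hp'
  have hlt := hC1 p hp κ hp'
  -- `dist1 ≥ 0`, so `0 < B₃'·δ'·η₁³` with `δ', η₁ > 0`
  have hpos : 0 < B₃' * δ 1 * P.eta 1 ^ 3 := lt_of_le_of_lt (GaugeGroup.dist1_nonneg _) hlt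
  by_contra hB
  rw [not_lt] at hB
  have : B₃' * δ 1 * P.eta 1 ^ 3 ≤ 0 :=
    mul_nonpos_of_nonpos_of_nonneg (mul_nonpos_of_nonpos_of_nonneg hB hδ'pos.le) hη3pos.le
  exact absurd hpos (not_lt.mpr this)

/-- **★★ THE CHEAP FLOOR OF THE C¹ SENTENCE: `VariationalThm1C1RegSepTop7M F N Sup B₃ B₃' a₀ a₁ → 0 < B₃'`** for EVERY top-domain selector `Sup`, every `N ≥ 1`, every
`B₃`, `0 < a₀`, `0 < a₁`, given ANY numerics `ν₀` with `0 < ν₀.M₁` (the guard) — the flat engine fed by the fact.  (No corner-engine instance exists for this edition —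
module docstring (1); def-P11's «expected floor» made kernel.)
[cite: Balaban1985Variational, Thm 1 (9)–(10) p.279; Balaban1988Convergent, (2.12) p.256 (bookkeeping)] -/
theorem pos_of_variationalThm1C1RegSepTop7M (Sup : (ν : Stage7Numerics) → (K : ℕ) → (ℕ → Set (Site (F.P K) 0)) → Set (Site (F.P K) 0))
    (ν₀ : Stage7Numerics) (hM₁ : 0 < ν₀.M₁) {B₃ B₃' a₀ a₁ : ℝ} (ha₀ : 0 < a₀) (ha₁ : 0 < a₁)
    (h : VariationalThm1C1RegSepTop7M F N Sup B₃ B₃' a₀ a₁) : 0 < B₃' :=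
  pos_of_top7C1BodyAt Sup ν₀ ha₀ ha₁ fun s hsep => h ν₀ 1 (fun _ => (1 : ℝ)) 1 1 s hsep hM₁

/-- Hence `¬ VariationalThm1C1RegSepTop7M F N Sup B₃ B₃' a₀ a₁` for every `B₃' ≤ 0` (`0 < a₀`, `0 < a₁`, some numerics with `0 < M₁`). [cite: Balaban1985Variational, Thm 1 (9)–(10) p.279 (bookkeeping)] -/
theorem not_variationalThm1C1RegSepTop7M_of_nonpos (Sup : (ν : Stage7Numerics) → (K : ℕ) → (ℕ → Set (Site (F.P K) 0)) → Set (Site (F.P K) 0))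
    (ν₀ : Stage7Numerics) (hM₁ : 0 < ν₀.M₁) {B₃ B₃' a₀ a₁ : ℝ} (ha₀ : 0 < a₀) (ha₁ : 0 < a₁) (hB : B₃' ≤ 0) :
    ¬ VariationalThm1C1RegSepTop7M F N Sup B₃ B₃' a₀ a₁ :=
  fun h => absurd (pos_of_variationalThm1C1RegSepTop7M Sup ν₀ hM₁ ha₀ ha₁ h) (not_lt.mpr hB)

/-- **★★ THE CHEAP FLOOR OF THE GUARDED v1.5 C¹ FACT: `VariationalThm1C1RegSepCoP7M F N B₃ B₃' a₀ a₁ → 0 < B₃'`** (every `N ≥ 1`, every `B₃`, `0 < a₀`, `0 < a₁`) —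
FILE 13's `…C1RegSepCoP7M` IS `…C1RegSepTop7M` at the selector `suppDomOfRecord` (`VariationalThm1C1RegSepCoP7M.toTop7M`); numerics `numerics7OfRecord₁₂` (`M₁ = 1`
meets the guard).  node00-def-K0a's composite keyed on `h15C1` carries this NECESSARY letter (it takes `0 ≤ B₃'`; at `B₃' = 0` the hypothesis is uninhabited).
[cite: Balaban1985Variational, Thm 1 (9)–(10) p.279; Balaban1988Convergent, (2.12) p.256 (bookkeeping)] -/
theorem pos_of_variationalThm1C1RegSepCoP7M {B₃ B₃' a₀ a₁ : ℝ} (ha₀ : 0 < a₀) (ha₁ : 0 < a₁)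
    (h : VariationalThm1C1RegSepCoP7M F N B₃ B₃' a₀ a₁) : 0 < B₃' :=
  pos_of_variationalThm1C1RegSepTop7M _ numerics7OfRecord₁₂ (by change 0 < 1; exact one_pos) ha₀ ha₁ h.toTop7M

/-- Hence `¬ VariationalThm1C1RegSepCoP7M F N B₃ B₃' a₀ a₁` for every `B₃' ≤ 0` (`0 < a₀`, `0 < a₁`). [cite: Balaban1985Variational, Thm 1 (9)–(10) p.279 (bookkeeping)] -/
theorem not_variationalThm1C1RegSepCoP7M_of_nonpos {B₃ B₃' a₀ a₁ : ℝ} (ha₀ : 0 < a₀) (ha₁ : 0 < a₁) (hB : B₃' ≤ 0) :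
    ¬ VariationalThm1C1RegSepCoP7M F N B₃ B₃' a₀ a₁ :=
  fun h => absurd (pos_of_variationalThm1C1RegSepCoP7M ha₀ ha₁ h) (not_lt.mpr hB)

/-- Truth set of the guarded v1.5 C¹ fact at a non-positive C¹ constant: only the degenerate corner `a₀ ≤ 0 ∨ a₁ ≤ 0`. [cite: Balaban1985Variational, Thm 1 (9)–(10) p.279 (bookkeeping)] -/
theorem variationalThm1C1RegSepCoP7M_degenerate_of_nonpos {B₃ B₃' a₀ a₁ : ℝ} (hB : B₃' ≤ 0)
    (h : VariationalThm1C1RegSepCoP7M F N B₃ B₃' a₀ a₁) : a₀ ≤ 0 ∨ a₁ ≤ 0 := by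
  by_contra hne
  push Not at hne
  exact not_variationalThm1C1RegSepCoP7M_of_nonpos hne.1 hne.2 hB h

end Floor

end Summit.QuantumFields.YangMills.Theorems.K0VariationalThm1C1Floor

end
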